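import Literature.MathematicalPhysics.QuantumFieldTheory.Balaban1983to89.B9Thm311Thm315FacesAtLettersR
import Literature.MathematicalPhysics.QuantumFieldTheory.Balaban1983to89.B9Thm311PosAtRecordV4
import Literature.MathematicalPhysics.QuantumFieldTheory.Balaban1983to89.Node00.OpsYSectDQ

/-!
# `Balaban1983to89.B9Thm311ReadingAtLettersQ` — T. Bałaban, *Propagators for lattice gauge theories in a background field*, Commun. Math. Phys. **99**
# (1985) 389–434 [Balaban1985BackgroundPropagators], THEOREM 3.11 p. 416: THE POSITIVITY READING OF ROW 17 RE-PRESSED ONCE, PARAMETRIC IN THE AVERAGING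
# TRANSPORTER `parA` (INSIDE Δ′_a ∕ Q′ ∕ R ∕ Δ_a — distinct from the record's Hölder-reading `𝔏.parS`, dag-n06-d's ask) AND IN THE AVERAGING PAIR `(Q, Qs)` — `Δ_a := Node00.deltaAQY` — with the transporter-specific facts DISPLAYED AS LAWS

statement-level skeleton of published theorems with citation tags; proofs where landed; nothing here is a claim about the Yang–Mills mass gap

THE PRINT.  Thm 3.11 p. 416: «the operators Δ′_a, G′, (Q′G′²Q′\*)⁻¹, Δ_a, G are positive definite … It is a symmetric and invertible operator»;
(3.24)–(3.27) pp. 394–395 (the five operators; `Δ_a = Δ + DRD* + Q*aQ`, `G = Δ_a⁻¹`); (3.12)–(3.13) p. 392 (the averaging `Q(U)` and its adjoint);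
[3] = *Propagators … I*, CMP **95** (1984), p. 25 (`Q′*` injective, `Q′G′²Q′*` positive).

WHY THIS FILE (cell `pub-ymgap`, node N06, seat `dag-n06-j` = bundle F5, gen 35; director-ym №383 «GO CASCADE-K», K2: «each pinned statement re-pressed ONCE
over `(parS, Gp)`, the parSymY-specific facts DISPLAYED AS LAWS» — my pinned legs by lineage = the row-17 reading).  `B9Thm311ReadingAtLetters.ops311Y x 𝔏 𝔔`
(this lineage, gen 5) hard-wires `DeltaA U := deltaAY x 𝔏.parS 𝔏.parB 𝔏.Gp U` — the straight-contour averaging `QY 𝔏.parB` inside — while `GA U := 𝔏.GA U`;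
at def-Y's knit record (`lettersYOfRecordV11K`: `.GA = GAQY (qKnitOfRecord …) (qsKnitOfRecord …) parKnitY …`) that reading would pair `Δ_a` at the straight
letter with `G` at the knit letter, and `inputs311_ops311Y`'s pin `𝔏.GA = GAY parS parB Gp` is false there.  THIS FILE re-presses the reading with the averaging
transporter and pair as PARAMETERS: `ops311YQ x 𝔏 parA Q Qs 𝔔` with `DeltaPa ∕ Qp ∕ Qps ∕ Cinv` at `parA` and `DeltaA U := deltaAQY x Q Qs parA 𝔏.Gp U` (def-Y `Node00/OpsYSectDQ`), the schema `Inputs311YQ`, the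
transport `inputs311Q_ops311YQ` under the pins `𝔏.Gp = GpY _ parA`, `𝔏.GA = GAQY _ Q Qs parA 𝔏.Gp` (both `rfl` at the knit record with `parA := parKnitY`), the row-17 face
`t311_of_pins_opsYOfLettersRQ` at generic `(R₁, R₂, c)`, and `inputs311YQ_of_laws` — the schema from the K2 LAWS: Δ′_a(U) positive and symmetric at `𝔏.parS`
(inhabited at `parKnitY` by dag-n06-l's `thm311_firstThree_parKnitY` ∕ `symm0_parKnitY`), unitary site transporters (for `Q′*` = adjoint of `Q′`), the
adjointness of `(Q U, Qs U)`, and «`Δ_a^Q(U)` symmetric and positive definite» (this lineage's `B9Thm311PosDefQknitOfRegYP335AtLettersY` at the straight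
site transporter; at `parKnitY` Thm 3.3's block is an open K2 law).  Today's reading is the instance `parA := 𝔏.parS`, `Q := QY _ 𝔏.parB`, `Qs := QsY _ 𝔏.parB` by `rfl`.

WHAT IS PROVED (sorry-free).  §1 `ops311YQ` (def), `ops311YQ_QY` (rfl onto `ops311Y`), the entry readings `posDefOfOps_ops311YQ_three ∕ _four`;
§2 `Inputs311YQ` (structure, Prop), ★ `isUnit_XY_of_site_inputs` ([3] p. 25 at the letters, from the four site clauses), ★★ `inputs311Q_ops311YQ`;
§3 ★★ `t311_of_pins_opsYOfLettersRQ` (row 17 at `opsYOfLetters … 𝔏 𝔈` on the R-class, pins + schema ⟹ `B9.Thm311Printed c …`);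
§4 ★★ `inputs311YQ_of_laws` (the schema at `𝔔 := proofLettersGA 𝔏` from the displayed laws and `PosDefTr 1 (deltaAQY …)`).
HONEST SCOPE.  One `def` + one `structure` (DEFINITION lane) re-pressing this lineage's gen-5∕7 reading; the laws are hypotheses with their inhabitants named;
nothing of [B9] asserted; NOT a node discharge; count-neutral; nothing continuum ∕ OS ∕ mass gap ∕ Clay.  No `sorry`, no `axiom`, no `instance`, no `notation`.
-/

noncomputable section

namespace Literature.MathematicalPhysics.QuantumFieldTheory.Balaban1983to89.B9Thm311ReadingAtLettersQ

open Literature.MathematicalPhysics.QuantumFieldTheory.Balaban1983to89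
open B9Thm311Whole B9Thm311ReadingCoords B9Thm311ReadingAtLetters B9Thm311PosAtRecordV4 Node00
open B6KLevelCensusIndexV1 B9PinMembersKLevelV1 B9PinCarriersKLevelV1 B9PinGeometryKLevelV1 B7Prop2SpecialUnitary
open B9BackgroundsKLevelV1R
open Literature.MathematicalPhysics.QuantumFieldTheory.Balaban1983to89.B9Thm311AdjointAtLetters (qpsY_injective isAdjTr_QpY_QpsY)
open Literature.MathematicalPhysics.QuantumFieldTheory.Balaban1983to89.B9Thm311DeltaPrimePos (posDefTr_ringInverse trIP_self_nonneg)
open Literature.MathematicalPhysics.QuantumFieldTheory.Balaban1983to89.B9Ineq349SiteAdjoint (isSymmTr_ringInverse)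
open scoped InnerProductSpace

/-! ## §1 The five operators with the averaging pair as a parameter -/

section Carrier

open scoped Matrix.Norms.L2Operator

variable {d ℓ : ℕ} {hd : 1 ≤ d + 1} {hL : Odd (ℓ + 1) ∧ 1 < ℓ + 1} {b₀ b₁ : ℝ} {Mstar : ℕ} {N : ℕ}

/-- ★ **THEOREM 3.11's FIVE OPERATORS AT THE LETTERS `𝔏` WITH THE AVERAGING PAIR `(Q, Qs)` AS A PARAMETER**: as `ops311Y` (this lineage), except
`DeltaA U := Δ_a^Q(U) = Δ(U) + D_UR(U)D*_U + Qs(U)∘a∘Q(U)` = def-Y's `deltaAQY x Q Qs parA 𝔏.Gp U` (Δ′_a, Q′, Q′*, C at `parA` too); `GA U = 𝔏.GA U` as before.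
[cite: Balaban1985BackgroundPropagators, Thm 3.11 p.416 + (3.24)–(3.27) pp.394–395] -/
def ops311YQ (x : MemberY d ℓ hd hL b₀ b₁ Mstar) (𝔏 : CovLettersY (Matrix (Fin N) (Fin N) ℂ) x)
    (parA : SiteParY (Matrix (Fin N) (Fin N) ℂ) x.toKIdx)
    (Q : CfgY (Matrix (Fin N) (Fin N) ℂ) x.toKIdx →
      ((FBondY x.toKIdx → Matrix (Fin N) (Fin N) ℂ) →ₗ[ℂ] (IBondY x.toKIdx → Matrix (Fin N) (Fin N) ℂ)))
    (Qs : CfgY (Matrix (Fin N) (Fin N) ℂ) x.toKIdx →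
      ((IBondY x.toKIdx → Matrix (Fin N) (Fin N) ℂ) →ₗ[ℂ] (FBondY x.toKIdx → Matrix (Fin N) (Fin N) ℂ)))
    (𝔔 : ProofLetters311 N x.toKIdx) :
    Ops311 (bg9Y (Matrix (Fin N) (Fin N) ℂ) (specialUnitaryUnits (Fin N)) x) (E311 N x.toKIdx) (F311 N x.toKIdx) (W311 N x.toKIdx) where
  DeltaPa U := conj311 (eS311 N x.toKIdx) (eS311 N x.toKIdx) (deltaPrimeAY x.toKIdx parA U)
  Gp U := conj311 (eS311 N x.toKIdx) (eS311 N x.toKIdx) (𝔏.Gp U)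
  Qp U := conj311 (eS311 N x.toKIdx) (eB311 N x.toKIdx) (QpY x.toKIdx parA U)
  Qps U := conj311 (eB311 N x.toKIdx) (eS311 N x.toKIdx) (QpsY x.toKIdx parA U)
  Cinv U := conj311 (eB311 N x.toKIdx) (eB311 N x.toKIdx) (XinvY x.toKIdx parA 𝔏.Gp U)
  G0 U := conj311 (eF311 N x.toKIdx) (eF311 N x.toKIdx) (𝔔.G0 U)
  R U := conj311 (eF311 N x.toKIdx) (eF311 N x.toKIdx) (𝔔.R U)
  GA U := conj311 (eF311 N x.toKIdx) (eF311 N x.toKIdx) (𝔏.GA U)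
  DeltaA U := conj311 (eF311 N x.toKIdx) (eF311 N x.toKIdx) (deltaAQY x.toKIdx Q Qs parA 𝔏.Gp U)

variable (x : MemberY d ℓ hd hL b₀ b₁ Mstar) (𝔏 : CovLettersY (Matrix (Fin N) (Fin N) ℂ) x)
  (parA : SiteParY (Matrix (Fin N) (Fin N) ℂ) x.toKIdx)
  (Q : CfgY (Matrix (Fin N) (Fin N) ℂ) x.toKIdx →
    ((FBondY x.toKIdx → Matrix (Fin N) (Fin N) ℂ) →ₗ[ℂ] (IBondY x.toKIdx → Matrix (Fin N) (Fin N) ℂ)))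
  (Qs : CfgY (Matrix (Fin N) (Fin N) ℂ) x.toKIdx →
    ((IBondY x.toKIdx → Matrix (Fin N) (Fin N) ℂ) →ₗ[ℂ] (FBondY x.toKIdx → Matrix (Fin N) (Fin N) ℂ)))
  (𝔔 : ProofLetters311 N x.toKIdx)

/-- today's reading is the instance at `parA := 𝔏.parS` and the straight-contour pair `(QY parB, QsY parB)` (def-Y's `deltaAQY_QY`). [cite: Balaban1985BackgroundPropagators, (3.26) p.395, bookkeeping] -/
theorem ops311YQ_QY : ops311YQ x 𝔏 𝔏.parS (QY x.toKIdx 𝔏.parB) (QsY x.toKIdx 𝔏.parB) 𝔔 = ops311Y x 𝔏 𝔔 := rfl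

/-- entry 3 READS «Δ_a^Q(U) is positive definite». [cite: Balaban1985BackgroundPropagators, Thm 3.11 p.416 + (3.26) p.395] -/
theorem posDefOfOps_ops311YQ_three (U : CfgY (Matrix (Fin N) (Fin N) ℂ) x.toKIdx) :
    PosDefOfOps (ops311YQ x 𝔏 parA Q Qs 𝔔) 3 U ↔ PosDefTr (fun _ => (1 : ℝ)) (deltaAQY x.toKIdx Q Qs parA 𝔏.Gp U) :=
  posDef_conj311_realify311_iff _

/-- entry 4 READS «G(U) is positive definite». [cite: Balaban1985BackgroundPropagators, Thm 3.11 p.416 + (3.27) p.395] -/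
theorem posDefOfOps_ops311YQ_four (U : CfgY (Matrix (Fin N) (Fin N) ℂ) x.toKIdx) :
    PosDefOfOps (ops311YQ x 𝔏 parA Q Qs 𝔔) 4 U ↔ PosDefTr (fun _ => (1 : ℝ)) (𝔏.GA U) :=
  posDef_conj311_realify311_iff _

/-! ## §2 The displayed schema and its transport to `Inputs311` under the two pins -/

/-- **THE INPUTS OF THE PRINTED PROOF AT THE LETTERS, AVERAGING PAIR `(Q, Qs)`** — `Inputs311Y` with `unitA` at `Δ_a^Q`: `pos0` ∕ `symm0` (Δ′_a at `parA`),
`adj` ∕ `qps_inj` (Q′* adjoint to Q′ for the block weight, injective), `unitA` (Δ_a^Q invertible), `symmG` (G symmetric), `posG0`, `fac`, `small` (the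
(3.105)–(3.106) proof letters). [cite: Balaban1985BackgroundPropagators, Thm 3.11 proof p.416 + (3.24)–(3.27) pp.394–395 + (3.105)–(3.106) p.414; Balaban1984PropagatorsI, p.25] -/
structure Inputs311YQ (θ₁ M : ℝ) (U : CfgY (Matrix (Fin N) (Fin N) ℂ) x.toKIdx) : Prop where
  pos0 : PosDefTr (fun _ => (1 : ℝ)) (deltaPrimeAY x.toKIdx parA U)
  symm0 : IsSymmTr (fun _ => (1 : ℝ)) (deltaPrimeAY x.toKIdx parA U)
  adj : IsAdjTr (fun _ => (1 : ℝ)) (wB x.toKIdx) (QpY x.toKIdx parA U) (QpsY x.toKIdx parA U)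
  qps_inj : Function.Injective (QpsY x.toKIdx parA U)
  unitA : IsUnit (deltaAQY x.toKIdx Q Qs parA 𝔏.Gp U)
  symmG : IsSymmTr (fun _ => (1 : ℝ)) (𝔏.GA U)
  posG0 : PosDefTr (fun _ => (1 : ℝ)) (𝔔.G0 U)
  fac : 𝔔.G0 U = 𝔏.GA U ∘ₗ (1 - 𝔔.R U)
  small : ∀ Ψ : FBondY x.toKIdx → Matrix (Fin N) (Fin N) ℂ,
    trIP (fun _ => (1 : ℝ)) Ψ (𝔔.R U Ψ) ≤ θ₁ * M⁻¹ * trIP (fun _ => (1 : ℝ)) Ψ Ψ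

variable {x 𝔏 parA Q Qs 𝔔}

/-- ★ **[3] p. 25 AT THE LETTERS, FROM THE FOUR SITE CLAUSES**: Δ′_a(U) positive and symmetric, `Q′*` the `W`-adjoint of `Q′` and injective, and the pin
`𝔏.Gp = GpY _ parA` give `IsUnit (Q′G′²Q′*)(U)` (this lineage's `isUnit_XY_of_inputs311Y`, re-keyed to the four clauses it uses).
[cite: Balaban1984PropagatorsI, p.25; Balaban1985BackgroundPropagators, (3.25) p.395] -/
theorem isUnit_XY_of_site_inputs (hGp : 𝔏.Gp = GpY x.toKIdx parA) {U : CfgY (Matrix (Fin N) (Fin N) ℂ) x.toKIdx}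
    (pos0 : PosDefTr (fun _ => (1 : ℝ)) (deltaPrimeAY x.toKIdx parA U)) (symm0 : IsSymmTr (fun _ => (1 : ℝ)) (deltaPrimeAY x.toKIdx parA U))
    (adj : IsAdjTr (fun _ => (1 : ℝ)) (wB x.toKIdx) (QpY x.toKIdx parA U) (QpsY x.toKIdx parA U))
    (qps_inj : Function.Injective (QpsY x.toKIdx parA U)) : IsUnit (XY x.toKIdx parA 𝔏.Gp U) := by
  have hu0 : IsUnit (deltaPrimeAY x.toKIdx parA U) := isUnit_of_posDefTr pos0
  have hright : ∀ v, conj311 (eS311 N x.toKIdx) (eS311 N x.toKIdx) (deltaPrimeAY x.toKIdx parA U)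
      (conj311 (eS311 N x.toKIdx) (eS311 N x.toKIdx) (𝔏.Gp U) v) = v := fun v => by
    rw [hGp]; exact conj311_apply_conj311_inverse _ hu0 v
  have hsymm0 := (symm_conj311_realify311_iff (w := fun _ : SiteY x.toKIdx => (1 : ℝ)) (hw := fun _ => one_pos)
    (deltaPrimeAY x.toKIdx parA U)).mpr symm0
  have hg : ∀ u v, inner ℝ (conj311 (eS311 N x.toKIdx) (eS311 N x.toKIdx) (𝔏.Gp U) u) v =
      inner ℝ u (conj311 (eS311 N x.toKIdx) (eS311 N x.toKIdx) (𝔏.Gp U) v) := fun u v => by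
    conv_lhs => rw [← hright v]
    conv_rhs => rw [← hright u]
    exact (hsymm0 _ _).symm
  have hginj : Function.Injective (conj311 (eS311 N x.toKIdx) (eS311 N x.toKIdx) (𝔏.Gp U)) := fun u v huv => by
    rw [← hright u, ← hright v, huv]
  have hadj := (adj_conj311_realify311_iff (w := fun _ : SiteY x.toKIdx => (1 : ℝ)) (hw := fun _ => one_pos)
    (w' := wB x.toKIdx) (hw' := wB_pos x.toKIdx) (QpY x.toKIdx parA U) (QpsY x.toKIdx parA U)).mpr adj
  have hqs := (injective_conj311_iff (eB311 N x.toKIdx) (eS311 N x.toKIdx) (QpsY x.toKIdx parA U)).mpr qps_inj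
  have hpd := posDef_qggqs hadj hg hginj hqs
  have hconj : conj311 (eS311 N x.toKIdx) (eB311 N x.toKIdx) (QpY x.toKIdx parA U) ∘ₗ
      conj311 (eS311 N x.toKIdx) (eS311 N x.toKIdx) (𝔏.Gp U) ∘ₗ conj311 (eS311 N x.toKIdx) (eS311 N x.toKIdx) (𝔏.Gp U) ∘ₗ
        conj311 (eB311 N x.toKIdx) (eS311 N x.toKIdx) (QpsY x.toKIdx parA U) =
      conj311 (eB311 N x.toKIdx) (eB311 N x.toKIdx) (XY x.toKIdx parA 𝔏.Gp U) := by
    rw [XY, conj311_comp (eY := eS311 N x.toKIdx), conj311_comp (eY := eS311 N x.toKIdx), conj311_comp (eY := eS311 N x.toKIdx)]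
  change B9Thm311Data.PosDef (conj311 (eS311 N x.toKIdx) (eB311 N x.toKIdx) (QpY x.toKIdx parA U) ∘ₗ
      conj311 (eS311 N x.toKIdx) (eS311 N x.toKIdx) (𝔏.Gp U) ∘ₗ conj311 (eS311 N x.toKIdx) (eS311 N x.toKIdx) (𝔏.Gp U) ∘ₗ
        conj311 (eB311 N x.toKIdx) (eS311 N x.toKIdx) (QpsY x.toKIdx parA U)) at hpd
  rw [hconj] at hpd
  exact isUnit_of_posDefTr ((posDef_conj311_realify311_iff _).mp hpd)

/-- ★★ **THE INPUTS OF `B9Thm311Whole` AT THE PARAMETRIC READING**: under the pins `𝔏.Gp = GpY _ parA` (G′ = (Δ′_a)⁻¹, (3.25)) and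
`𝔏.GA = GAQY _ Q Qs parA 𝔏.Gp` (G = (Δ_a^Q)⁻¹, (3.27) — def-Y's v10∕v11 records by `rfl`), `Inputs311YQ … U` yields `Inputs311 (ops311YQ x 𝔏 parA Q Qs 𝔔) θ₁ M U`;
`gp_right`, `c_right`, `da_right` are PROVED (two-sided inverses of units). [cite: Balaban1985BackgroundPropagators, Thm 3.11 proof p.416 + (3.25)–(3.27) p.395; Balaban1984PropagatorsI, p.25] -/
theorem inputs311Q_ops311YQ (hGp : 𝔏.Gp = GpY x.toKIdx parA) (hGA : 𝔏.GA = GAQY x.toKIdx Q Qs parA 𝔏.Gp) {θ₁ M : ℝ}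
    {U : CfgY (Matrix (Fin N) (Fin N) ℂ) x.toKIdx} (h : Inputs311YQ x 𝔏 parA Q Qs 𝔔 θ₁ M U) : Inputs311 (ops311YQ x 𝔏 parA Q Qs 𝔔) θ₁ M U where
  pos0 := (posDef_conj311_realify311_iff _).mpr h.pos0
  symm0 := (symm_conj311_realify311_iff _).mpr h.symm0
  gp_right v := by
    change conj311 (eS311 N x.toKIdx) (eS311 N x.toKIdx) (deltaPrimeAY x.toKIdx parA U)
      (conj311 (eS311 N x.toKIdx) (eS311 N x.toKIdx) (𝔏.Gp U) v) = v
    rw [hGp]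
    exact conj311_apply_conj311_inverse _ (isUnit_of_posDefTr h.pos0) v
  adj := (adj_conj311_realify311_iff _ _).mpr h.adj
  qps_inj := (injective_conj311_iff _ _ _).mpr h.qps_inj
  c_right φ := by
    have hX := apply_inverse_of_isUnit (isUnit_XY_of_site_inputs hGp h.pos0 h.symm0 h.adj h.qps_inj) ((eB311 N x.toKIdx).symm φ)
    have hX' := congrArg (eB311 N x.toKIdx) hX
    rw [LinearEquiv.apply_symm_apply] at hX'
    simpa [ops311YQ, XY, XinvY] using hX'
  posG0 := (posDef_conj311_realify311_iff _).mpr h.posG0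
  symmG := (symm_conj311_realify311_iff _).mpr h.symmG
  fac := by
    change conj311 (eF311 N x.toKIdx) (eF311 N x.toKIdx) (𝔔.G0 U) =
      conj311 (eF311 N x.toKIdx) (eF311 N x.toKIdx) (𝔏.GA U) ∘ₗ (1 - conj311 (eF311 N x.toKIdx) (eF311 N x.toKIdx) (𝔔.R U))
    rw [h.fac, conj311_comp (eY := eF311 N x.toKIdx), conj311_one_sub]
  small := (small_conj311_realify311_iff _ _).mpr h.small
  da_right v := by
    change conj311 (eF311 N x.toKIdx) (eF311 N x.toKIdx) (𝔏.GA U)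
      (conj311 (eF311 N x.toKIdx) (eF311 N x.toKIdx) (deltaAQY x.toKIdx Q Qs parA 𝔏.Gp U) v) = v
    rw [hGA]
    exact conj311_inverse_apply_conj311 _ h.unitA v

end Carrier

/-! ## §3 ★★ Row 17 at the parametric reading, on the R-class -/

section Row17

open scoped Matrix.Norms.L2Operator

variable {N : ℕ} (θ : Stage3Params) (Mstar : ℕ) (𝔏 : LettersY N θ Mstar) (𝔈 : ExpsY N θ Mstar)
variable (R₁ R₂ : RegFamY θ.d₆ θ.ℓ₆ θ.hd' θ.hL' θ.b₀ θ.b₁ Mstar (Matrix (Fin N) (Fin N) ℂ))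

/-- ★★ **ROW 17 OF THE N06 KNIT AT `opsYOfLetters N θ M⋆ 𝔏 𝔈` WITH THE AVERAGING FAMILY `(𝔮, 𝔮s)` AND THE LETTERS PINNED, GENERIC `(R₁, R₂, c)`**
(`t311_of_pins_opsYOfLettersR` re-pressed: the pins name `GpY _ (parA _)` and `GAQY _ (𝔮 _) (𝔮s _) (parA _) 𝔏.Gp`, the positivity field is pinned to `ops311YQ`, the schema is
`Inputs311YQ`): `B9.Thm311Printed c geo9Y (bg9YR … R₁ R₂) (fun x => (opsYOfLetters … x).PosDef)`; printed quantifiers met with `M₃ := max M₁ 2θ₁`, `a₀ := a₁`.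
[cite: Balaban1985BackgroundPropagators, Thm 3.11 p.416 + (3.24)–(3.27) pp.394–395 + (3.35) p.396; Balaban1984PropagatorsI, p.25] -/
theorem t311_of_pins_opsYOfLettersRQ
    (parA : ∀ x : MemberY θ.d₆ θ.ℓ₆ θ.hd' θ.hL' θ.b₀ θ.b₁ Mstar, SiteParY (Matrix (Fin N) (Fin N) ℂ) x.toKIdx)
    (𝔮 : ∀ x : MemberY θ.d₆ θ.ℓ₆ θ.hd' θ.hL' θ.b₀ θ.b₁ Mstar, CfgY (Matrix (Fin N) (Fin N) ℂ) x.toKIdx →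
      ((FBondY x.toKIdx → Matrix (Fin N) (Fin N) ℂ) →ₗ[ℂ] (IBondY x.toKIdx → Matrix (Fin N) (Fin N) ℂ)))
    (𝔮s : ∀ x : MemberY θ.d₆ θ.ℓ₆ θ.hd' θ.hL' θ.b₀ θ.b₁ Mstar, CfgY (Matrix (Fin N) (Fin N) ℂ) x.toKIdx →
      ((IBondY x.toKIdx → Matrix (Fin N) (Fin N) ℂ) →ₗ[ℂ] (FBondY x.toKIdx → Matrix (Fin N) (Fin N) ℂ)))
    (𝔔 : ∀ x : MemberY θ.d₆ θ.ℓ₆ θ.hd' θ.hL' θ.b₀ θ.b₁ Mstar, ProofLetters311 N x.toKIdx)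
    (c θ₁ a₁ M₁ : ℝ) (ha₁ : 0 < a₁) (hM₁ : 0 < M₁)
    (hGp : ∀ x : MemberY θ.d₆ θ.ℓ₆ θ.hd' θ.hL' θ.b₀ θ.b₁ Mstar, (𝔏 x).Gp = GpY x.toKIdx (parA x))
    (hGA : ∀ x : MemberY θ.d₆ θ.ℓ₆ θ.hd' θ.hL' θ.b₀ θ.b₁ Mstar, (𝔏 x).GA = GAQY x.toKIdx (𝔮 x) (𝔮s x) (parA x) (𝔏 x).Gp)
    (h311 : ∀ x : MemberY θ.d₆ θ.ℓ₆ θ.hd' θ.hL' θ.b₀ θ.b₁ Mstar, M₁ ≤ (geo9Y x).M → ∀ α₀ : ℝ, 0 < α₀ → (geo9Y x).M * α₀ ≤ a₁ →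
      ∀ U : (bg9YR (Matrix (Fin N) (Fin N) ℂ) (specialUnitaryUnits (Fin N)) R₁ R₂ x).Cfg,
        (bg9YR (Matrix (Fin N) (Fin N) ℂ) (specialUnitaryUnits (Fin N)) R₁ R₂ x).Reg335 c α₀ U →
          Inputs311YQ x (𝔏 x) (parA x) (𝔮 x) (𝔮s x) (𝔔 x) θ₁ (geo9Y x).M U)
    (hPD : ∀ x : MemberY θ.d₆ θ.ℓ₆ θ.hd' θ.hL' θ.b₀ θ.b₁ Mstar,
      ((opsYOfLetters N θ Mstar 𝔏 𝔈) x).PosDef = PosDefOfOps (ops311YQ x (𝔏 x) (parA x) (𝔮 x) (𝔮s x) (𝔔 x))) :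
    B9.Thm311Printed c geo9Y (bg9YR (Matrix (Fin N) (Fin N) ℂ) (specialUnitaryUnits (Fin N)) R₁ R₂)
      (fun x => ((opsYOfLetters N θ Mstar 𝔏 𝔈) x).PosDef) := by
  refine ⟨max M₁ (2 * θ₁), a₁, lt_max_of_lt_left hM₁, ha₁, fun x hM α₀ hα₀ hMa U hU n => ?_⟩
  have hM₁x : M₁ ≤ (geo9Y x).M := le_trans (le_max_left _ _) hM
  have hMpos : 0 < (geo9Y x).M := lt_of_lt_of_le hM₁ hM₁x
  have hI : Inputs311 (ops311YQ x (𝔏 x) (parA x) (𝔮 x) (𝔮s x) (𝔔 x)) θ₁ (geo9Y x).M U :=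
    inputs311Q_ops311YQ (hGp x) (hGA x) (h311 x hM₁x α₀ hα₀ hMa U hU)
  have hgoal : PosDefOfOps (ops311YQ x (𝔏 x) (parA x) (𝔮 x) (𝔮s x) (𝔔 x)) n U :=
    posDefOfOps_all _ hMpos (le_trans (le_max_right _ _) hM) hI n
  have hPDx := congrFun (congrFun (hPD x) n) U
  exact Eq.mpr hPDx hgoal

end Row17

/-! ## §4 ★★ The schema from the K2 laws at the trivial proof letters `proofLettersGA 𝔏` -/

section Laws

open scoped Matrix.Norms.L2Operator

variable {d ℓ : ℕ} {hd : 1 ≤ d + 1} {hL : Odd (ℓ + 1) ∧ 1 < ℓ + 1} {b₀ b₁ : ℝ} {Mstar : ℕ} {N : ℕ}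

/-- ★★ **`Inputs311YQ` FROM THE DISPLAYED K2 LAWS**, at the trivial proof letters `G₀ := G`, `R := 0` (`proofLettersGA 𝔏`): for a `G`-valued `U` (`G ≤ U(N)`)
and `G`-valued averaging transporters `parA U` (so `Q′*` is the `W`-adjoint of `Q′`, `isAdjTr_QpY_QpsY`; injectivity `qpsY_injective` holds at every table),
the SITE laws «Δ′_a(U) positive and symmetric at `parA`» (at `parKnitY`: dag-n06-l's `thm311_firstThree_parKnitY`, `symm0_parKnitY`), the BOND laws
«`Δ_a^Q(U)` symmetric and positive definite» (this lineage's `B9Thm311PosDefAveragingSwap.deltaAQY_isSymmTr` ∕ `B9Thm311PosDefQknitOfRegYP335AtLettersY` at the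
straight site transporter; at `parKnitY` resting on Thm 3.3's block there, an open K2 law) and the pin `𝔏.GA = GAQY _ Q Qs 𝔏.parS 𝔏.Gp`: all nine clauses
(any `θ₁, M ≥ 0`). [cite: Balaban1985BackgroundPropagators, Thm 3.11 p.416, (3.24)–(3.27) pp.394–395, (3.35) p.396; Balaban1984PropagatorsI, p.25] -/
theorem inputs311YQ_of_laws {G : Subgroup (Matrix (Fin N) (Fin N) ℂ)ˣ} (hG : G ≤ B7Prop2Explicit.unitaryUnits (Matrix (Fin N) (Fin N) ℂ))
    (x : MemberY d ℓ hd hL b₀ b₁ Mstar) (𝔏 : CovLettersY (Matrix (Fin N) (Fin N) ℂ) x)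
    (Q : CfgY (Matrix (Fin N) (Fin N) ℂ) x.toKIdx →
      ((FBondY x.toKIdx → Matrix (Fin N) (Fin N) ℂ) →ₗ[ℂ] (IBondY x.toKIdx → Matrix (Fin N) (Fin N) ℂ)))
    (Qs : CfgY (Matrix (Fin N) (Fin N) ℂ) x.toKIdx →
      ((IBondY x.toKIdx → Matrix (Fin N) (Fin N) ℂ) →ₗ[ℂ] (FBondY x.toKIdx → Matrix (Fin N) (Fin N) ℂ)))
    (parA : SiteParY (Matrix (Fin N) (Fin N) ℂ) x.toKIdx)
    (hGA : 𝔏.GA = GAQY x.toKIdx Q Qs parA 𝔏.Gp) {θ₁ M : ℝ} (hθ₁ : 0 ≤ θ₁) (hM : 0 ≤ M)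
    {U : CfgY (Matrix (Fin N) (Fin N) ℂ) x.toKIdx} (hparA : ∀ z w : SiteY x.toKIdx, parA U z w ∈ G)
    (pos0 : PosDefTr (fun _ => (1 : ℝ)) (deltaPrimeAY x.toKIdx parA U)) (symm0 : IsSymmTr (fun _ => (1 : ℝ)) (deltaPrimeAY x.toKIdx parA U))
    (symmA : IsSymmTr (fun _ => (1 : ℝ)) (deltaAQY x.toKIdx Q Qs parA 𝔏.Gp U))
    (hA : PosDefTr (fun _ => (1 : ℝ)) (deltaAQY x.toKIdx Q Qs parA 𝔏.Gp U)) :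
    Inputs311YQ x 𝔏 parA Q Qs (proofLettersGA 𝔏) θ₁ M U where
  pos0 := pos0
  symm0 := symm0
  adj := isAdjTr_QpY_QpsY x.toKIdx parA U fun s z => B7Prop2Explicit.mem_unitaryUnits.1 (hG (hparA _ _))
  qps_inj := qpsY_injective x.toKIdx parA U
  unitA := isUnit_of_posDefTr hA
  symmG := by rw [hGA]; exact isSymmTr_ringInverse _ symmA
  posG0 := by
    change PosDefTr (fun _ => (1 : ℝ)) (𝔏.GA U)
    rw [hGA]
    exact posDefTr_ringInverse hA
  fac := by
    change 𝔏.GA U = 𝔏.GA U ∘ₗ (1 - 0)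
    rw [sub_zero, Module.End.one_eq_id, LinearMap.comp_id]
  small := by
    intro Ψ
    change trIP (fun _ => (1 : ℝ)) Ψ ((0 : (FBondY x.toKIdx → Matrix (Fin N) (Fin N) ℂ) →ₗ[ℂ] _) Ψ) ≤ _
    rw [LinearMap.zero_apply, trIP_zero_right]
    exact mul_nonneg (mul_nonneg hθ₁ (inv_nonneg.2 hM)) (trIP_self_nonneg _ (fun _ => one_pos) Ψ)

end Laws

end Literature.MathematicalPhysics.QuantumFieldTheory.Balaban1983to89.B9Thm311ReadingAtLettersQ

end
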